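import Summits.QuantumFields.YangMills.Theorems.BalabanUVNodesN19KinkExactSignJackson

/-!
# YM-DAG node N19 (= NE7 proper) — THE LEVEL STATISTICS OF A KINK-EXACT LADDER LIVE IN A CROSS-POLYTOPE
# (`Σ_l 2^l·|p_{2^{l+1}}(x) − p_{2^l}(x)| ≤ 128 + 3C₀∕512` uniformly on `[−1,1]` and in the number of levels; on the cube `≤ (128 + 3C₀∕512)·d`)

Cell `pub-ymgap`, HUMAN RULING D-0062 (Track A) ∕ D-0149 (work-bound push), R141 (C) wider-strategy seat `pub-ymgap-dag-n19-e` (strategy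
s3 = ALTERNATIVE CURRENCY), generation g36, module 2 (lineage module 197).  Route `Summits/QuantumFields/YangMills/Theses/BalabanUVNodes.lean`,
cluster item K3⁸ «SpineGivenEndpointR13SepCoPHV» (stmt-QuantumFields-27366); filed `--supports` that item `--as helper` (it proves no registered
stub).  COUNT-NEUTRAL: elementary real bookkeeping (dyadic splitting of a geometric–polynomial profile, `exists_nat_pow_near`, `geom_sum_eq`) over
Mathlib and, BY NAME, module 196 `…N19KinkExactSignJackson` (`exists_kinkExact_poly_near_abs`); no laws, no scheme object, no Theses import; NOT a
discharge claim.

ROLE IN THE LINEAGE (HOME `numerics/OPEN-PROBLEM.md`, g36 addendum «model (M″)»).  The ladders of this lineage (modules 118–195) write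
`S_d = Σ_i|x_i| = A_0 + Σ_l (A_{l+1} − A_l) + (S_d − A_J)` with ADDITIVE inner approximants `A_l(x) = Σ_i p_{2^l}(x_i)` and treat the normalised level
statistics `θ_l = 2^l·(A_{l+1} − A_l)∕(c·d) ∈ [−1,1]` as FREE box variables; g35 proved (paper, model (M′)) that on the free box the character
`e^{iΩ Σ_l 2^{−l}θ_l}` costs weighted degree `Θ(Ω·log Ω)` — the logarithm of the general row `dist_∞(h∘S_d, Π_t) ≲ K·d·log t∕t` is forced there.
THIS MODULE: with the kink-exact, polynomially localised inner approximants of module 196 (`p_L(0) = 0`, `||x| − p_L(x)| ≤ min(2|x|, C₀∕(L³x²))`,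
`C₀ = π⁷∕3`) the level statistics are NOT free: (§1) for ANY family `p_l` with `||x| − p_l(x)| ≤ 2|x|` and `≤ C₀∕(8^l x²)` (`l` = dyadic level,
degree `≍ 2^l`), `Σ_{l<J} 2^l·|p_{l+1}(x) − p_l(x)| ≤ 128 + 3C₀∕512` for every `x ∈ [−1,1]` and every `J` (split at the level `m` with `2^m|x| ≤ 16 <
2^{m+1}|x|`: below it the increments are `≤ 4|x|`, a geometric series `≤ 128`; above it `≤ (9∕8)C₀∕(4^l x²)`, a geometric series `≤ 3C₀∕512`);
(§2) on the cube, `Σ_{l<J} 2^l·|A_{l+1}(x) − A_l(x)| ≤ (128 + 3C₀∕512)·|ι|`: **the vector of level statistics lies in an `ℓ¹`-BALL (cross-polytope) of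
radius `≍ d`, uniformly in the number of levels** — whereas the box of (M′) has `ℓ¹`-radius `≍ d·(J+1)`; (§3) module 196's family instantiates §1∕§2
(`C₀ = π⁷∕3`, bound `≤ 134`); (§4) CONTRAST: for any family whose value AT THE KINK is pinned to `[a∕2^l, b∕2^l]` with `b < 2a` (plain Fejér ∕ Jackson
means of `|x|`, whose value at `0` is `≍ 1∕L`) the level sum at `x = 0` is `≥ J·(a − b∕2)` — linear in the number of levels: kink-exactness is what
puts the statistics in the cross-polytope.  CONSEQUENCE FOR THE OPEN ROW (paper): a log-free construction, if any, must (i) use kink-exact inner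
approximants and (ii) exploit `Σ_l|θ_l| ≲ 1` NON-tensorially — products over levels cannot (Bernstein's inequality forces per-level degree
`≍ Ω2^{−l}` in `θ_l` whatever the load), and the plain weighted-degree truncation of the joint Taylor series fails at mixed load profiles.

HONEST FRAMING (binding).  Elementary bookkeeping about the seat's own upper-bound method (degree model); constants crude (`128 + 3C₀∕512 ≤ 134` at
`C₀ = π⁷∕3`); NO consumer in the DAG today; nothing of Bałaban's instantiated; NE7 NOT PRINTED, NOT proved; N19 NOT discharged; count-neutral.
One finite `T⁴` programme at fixed `ε`; nothing continuum ∕ `ℝ⁴` ∕ OS ∕ mass-gap ∕ Clay.  0 `def` ∕ 0 `sorry`.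
-/

noncomputable section

open Finset Polynomial
open scoped Real

namespace Summit.QuantumFields.YangMills.Theorems.BalabanUVNodesN19LevelStatisticsCrossPolytope

open Summit.QuantumFields.YangMills.Theorems.BalabanUVNodesN19KinkExactSignJackson (exists_kinkExact_poly_near_abs)

/-! ## §1 One coordinate: the dyadic level sum is bounded uniformly in `x` and in the number of levels [bookkeeping] -/

/-- `Σ_{j<J} (1∕4)^j ≤ 4∕3`. [bookkeeping] -/
theorem geom_sum_quarter_le (J : ℕ) : ∑ j ∈ range J, (1 / 4 : ℝ) ^ j ≤ 4 / 3 := by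
  rw [geom_sum_eq (by norm_num) J]
  have h : (0 : ℝ) ≤ (1 / 4 : ℝ) ^ J := by positivity
  have e : ((1 / 4 : ℝ) ^ J - 1) / (1 / 4 - 1) = (4 / 3) * (1 - (1 / 4 : ℝ) ^ J) := by field_simp; ring
  rw [e]; nlinarith

/-- `Σ_{l ≤ m} 2^l ≤ 2^{m+1}` (as reals). [bookkeeping] -/
theorem sum_two_pow_le (m : ℕ) : ∑ l ∈ range (m + 1), (2 : ℝ) ^ l ≤ 2 ^ (m + 1) := by
  have h := geom_sum_eq (show (2 : ℝ) ≠ 1 by norm_num) (m + 1)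
  rw [h]; norm_num

/-- ★★ **THE DYADIC LEVEL SUM OF ONE COORDINATE.**  Let `p_l : ℝ → ℝ` (`l ∈ ℕ`, think `p_l = ` a degree-`≍ 2^l` approximant of `|·|`) satisfy on `[−1,1]`
`||x| − p_l(x)| ≤ 2|x|` and, for `x ≠ 0`, `||x| − p_l(x)| ≤ C₀∕(8^l·x²)` (`C₀ ≥ 0`).  Then for every `J` and every `x ∈ [−1,1]`:
`Σ_{l<J} 2^l·|p_{l+1}(x) − p_l(x)| ≤ 128 + 3C₀∕512`.  Proof: `x = 0` is trivial (`p_l(0) = 0`); else pick `m` with `2^m ≤ 16∕|x| < 2^{m+1}`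
(`exists_nat_pow_near`); for `l ≤ m` the term is `≤ 4·2^l|x|`, summing to `≤ 8·2^m|x| ≤ 128`; for `l ≥ m + 1` it is `≤ (9∕8)C₀∕(4^l x²) =
(9∕8)C₀∕(4^{l−m−1}(2^{m+1}|x|)²) ≤ (9C₀∕2048)·4^{−(l−m−1)}`, summing to `≤ (9C₀∕2048)(4∕3) = 3C₀∕512`. [bookkeeping] -/
theorem sum_two_pow_mul_abs_increment_le {p : ℕ → ℝ → ℝ} {C₀ : ℝ} (hC : 0 ≤ C₀)
    (ha : ∀ (l : ℕ) (x : ℝ), x ∈ Set.Icc (-1 : ℝ) 1 → |(|x|) - p l x| ≤ 2 * |x|)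
    (hb : ∀ (l : ℕ) (x : ℝ), x ∈ Set.Icc (-1 : ℝ) 1 → x ≠ 0 → |(|x|) - p l x| ≤ C₀ / (8 ^ l * x ^ 2))
    (J : ℕ) {x : ℝ} (hx : x ∈ Set.Icc (-1 : ℝ) 1) :
    ∑ l ∈ range J, (2 : ℝ) ^ l * |p (l + 1) x - p l x| ≤ 128 + 3 * C₀ / 512 := by
  -- increments from the two error bounds
  have hinc : ∀ l : ℕ, |p (l + 1) x - p l x| ≤ |(|x|) - p (l + 1) x| + |(|x|) - p l x| := fun l => by
    calc |p (l + 1) x - p l x| = |((|x|) - p l x) - ((|x|) - p (l + 1) x)| := by ring_nf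
      _ ≤ |(|x|) - p l x| + |(|x|) - p (l + 1) x| := abs_sub _ _
      _ = _ := add_comm _ _
  by_cases hx0 : x = 0
  · -- at the kink every term vanishes
    have hz : ∀ l : ℕ, p l x = 0 := fun l => by
      have h := ha l x hx
      rw [hx0, abs_zero, mul_zero, zero_sub, abs_neg] at h
      have := abs_nonneg (p l 0)
      rw [hx0]; exact abs_eq_zero.1 (le_antisymm h this)
    have : ∑ l ∈ range J, (2 : ℝ) ^ l * |p (l + 1) x - p l x| = 0 := Finset.sum_eq_zero fun l _ => by rw [hz, hz, sub_zero, abs_zero, mul_zero]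
    rw [this]; positivity
  -- the dyadic split level `m`
  set a : ℝ := |x| with ha_def
  have ha0 : 0 < a := abs_pos.2 hx0
  have ha1 : a ≤ 1 := abs_le.2 ⟨hx.1, hx.2⟩
  have hx2 : x ^ 2 = a ^ 2 := (sq_abs x).symm
  obtain ⟨m, hm1, hm2⟩ := exists_nat_pow_near (show (1 : ℝ) ≤ 16 / a by rw [le_div_iff₀ ha0]; linarith) one_lt_two
  have hlow : (2 : ℝ) ^ m * a ≤ 16 := by
    have := mul_le_mul_of_nonneg_right hm1 ha0.le; rwa [div_mul_cancel₀ _ ha0.ne'] at this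
  have hhigh : 16 < (2 : ℝ) ^ (m + 1) * a := by
    have := mul_lt_mul_of_pos_right hm2 ha0; rwa [div_mul_cancel₀ _ ha0.ne'] at this
  -- the two termwise bounds
  have hA : ∀ l : ℕ, (2 : ℝ) ^ l * |p (l + 1) x - p l x| ≤ 4 * (2 ^ l * a) := fun l => by
    have h := (hinc l).trans (add_le_add (ha (l + 1) x hx) (ha l x hx))
    calc (2 : ℝ) ^ l * |p (l + 1) x - p l x| ≤ 2 ^ l * (2 * a + 2 * a) := mul_le_mul_of_nonneg_left h (by positivity)
      _ = 4 * (2 ^ l * a) := by ring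
  have hB : ∀ l : ℕ, (2 : ℝ) ^ l * |p (l + 1) x - p l x| ≤ (9 / 8) * C₀ / (4 ^ l * a ^ 2) := fun l => by
    have h := (hinc l).trans (add_le_add (hb (l + 1) x hx hx0) (hb l x hx hx0))
    rw [hx2] at h
    have e : C₀ / (8 ^ (l + 1) * a ^ 2) + C₀ / (8 ^ l * a ^ 2) = (9 / 8) * C₀ / (8 ^ l * a ^ 2) := by
      rw [pow_succ]; field_simp; ring
    rw [e] at h
    have e8 : (8 : ℝ) ^ l = 2 ^ l * 4 ^ l := by rw [← mul_pow]; norm_num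
    calc (2 : ℝ) ^ l * |p (l + 1) x - p l x| ≤ 2 ^ l * ((9 / 8) * C₀ / (8 ^ l * a ^ 2)) := mul_le_mul_of_nonneg_left h (by positivity)
      _ = (9 / 8) * C₀ / (4 ^ l * a ^ 2) := by rw [e8]; field_simp
  -- split the sum at `m`
  rw [← Finset.sum_filter_add_sum_filter_not (range J) (fun l => l ≤ m)]
  have hS1 : ∑ l ∈ (range J).filter (fun l => l ≤ m), (2 : ℝ) ^ l * |p (l + 1) x - p l x| ≤ 128 := by
    calc ∑ l ∈ (range J).filter (fun l => l ≤ m), (2 : ℝ) ^ l * |p (l + 1) x - p l x|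
        ≤ ∑ l ∈ (range J).filter (fun l => l ≤ m), 4 * (2 ^ l * a) := Finset.sum_le_sum fun l _ => hA l
      _ ≤ ∑ l ∈ range (m + 1), 4 * ((2 : ℝ) ^ l * a) := by
          refine Finset.sum_le_sum_of_subset_of_nonneg (fun l hl => ?_) fun l _ _ => by positivity
          simp only [Finset.mem_filter, Finset.mem_range] at hl ⊢; omega
      _ = 4 * a * ∑ l ∈ range (m + 1), (2 : ℝ) ^ l := by rw [Finset.mul_sum]; exact Finset.sum_congr rfl fun l _ => by ring
      _ ≤ 4 * a * 2 ^ (m + 1) := mul_le_mul_of_nonneg_left (sum_two_pow_le m) (by positivity)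
      _ = 8 * (2 ^ m * a) := by rw [pow_succ]; ring
      _ ≤ 128 := by linarith
  have hS2 : ∑ l ∈ (range J).filter (fun l => ¬ l ≤ m), (2 : ℝ) ^ l * |p (l + 1) x - p l x| ≤ 3 * C₀ / 512 := by
    have hK : 0 ≤ (9 / 8) * C₀ / (256 : ℝ) := by positivity
    calc ∑ l ∈ (range J).filter (fun l => ¬ l ≤ m), (2 : ℝ) ^ l * |p (l + 1) x - p l x|
        ≤ ∑ l ∈ (range J).filter (fun l => ¬ l ≤ m), (9 / 8) * C₀ / (4 ^ l * a ^ 2) := Finset.sum_le_sum fun l _ => hB l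
      _ ≤ ∑ l ∈ Ico (m + 1) (m + 1 + J), (9 / 8) * C₀ / ((4 : ℝ) ^ l * a ^ 2) := by
          refine Finset.sum_le_sum_of_subset_of_nonneg (fun l hl => ?_) fun l _ _ => by positivity
          simp only [Finset.mem_filter, Finset.mem_range, Finset.mem_Ico] at hl ⊢; omega
      _ = ∑ j ∈ range J, (9 / 8) * C₀ / ((4 : ℝ) ^ (m + 1 + j) * a ^ 2) := by
          rw [Finset.sum_Ico_eq_sum_range]; simp only [add_tsub_cancel_left]
      _ ≤ ∑ j ∈ range J, ((9 / 8) * C₀ / 256) * (1 / 4 : ℝ) ^ j := by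
          refine Finset.sum_le_sum fun j _ => ?_
          have h256 : (256 : ℝ) ≤ 4 ^ (m + 1) * a ^ 2 := by
            have e4 : (4 : ℝ) ^ (m + 1) = (2 ^ (m + 1)) ^ 2 := by
              rw [← pow_mul, mul_comm (m + 1) 2, pow_mul]; norm_num
            have e : (4 : ℝ) ^ (m + 1) * a ^ 2 = (2 ^ (m + 1) * a) ^ 2 := by rw [e4, mul_pow]
            have hpos : (0 : ℝ) < 2 ^ (m + 1) * a := by positivity
            rw [e]; nlinarith
          have h4j : (0 : ℝ) < 4 ^ j := by positivity
          have hden : (256 : ℝ) * 4 ^ j ≤ 4 ^ (m + 1 + j) * a ^ 2 := by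
            calc (256 : ℝ) * 4 ^ j ≤ (4 ^ (m + 1) * a ^ 2) * 4 ^ j := mul_le_mul_of_nonneg_right h256 h4j.le
              _ = 4 ^ (m + 1 + j) * a ^ 2 := by rw [pow_add]; ring
          calc (9 / 8 : ℝ) * C₀ / (4 ^ (m + 1 + j) * a ^ 2) ≤ (9 / 8) * C₀ / (256 * 4 ^ j) :=
                div_le_div_of_nonneg_left (by positivity) (by positivity) hden
            _ = ((9 / 8) * C₀ / 256) * (1 / 4 : ℝ) ^ j := by rw [one_div_pow]; field_simp
      _ = ((9 / 8) * C₀ / 256) * ∑ j ∈ range J, (1 / 4 : ℝ) ^ j := by rw [Finset.mul_sum]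
      _ ≤ ((9 / 8) * C₀ / 256) * (4 / 3) := mul_le_mul_of_nonneg_left (geom_sum_quarter_le J) hK
      _ = 3 * C₀ / 512 := by ring
  linarith

/-! ## §2 The cube: the level statistics of an additive kink-exact ladder lie in an `ℓ¹`-ball of radius `≍ d` [bookkeeping] -/

/-- ★★ **THE LEVEL STATISTICS OF AN ADDITIVE KINK-EXACT LADDER LIVE IN A CROSS-POLYTOPE.**  With `A_l(x) = Σ_i p_l(x_i)` for a family as in §1 and
ANY point `x` of the cube `[−1,1]^ι`: `Σ_{l<J} 2^l·|A_{l+1}(x) − A_l(x)| ≤ (128 + 3C₀∕512)·|ι|`, uniformly in `J` — i.e. the normalised level statistics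
`θ_l(x) = 2^l(A_{l+1} − A_l)(x)∕((128 + 3C₀∕512)|ι|)` satisfy `Σ_l|θ_l(x)| ≤ 1` (an `ℓ¹`-ball), whereas the free box `[−1,1]^{J}` of model (M′) has
`ℓ¹`-radius `J`. [bookkeeping] -/
theorem sum_two_pow_mul_abs_additive_increment_le {ι : Type*} [Fintype ι] {p : ℕ → ℝ → ℝ} {C₀ : ℝ} (hC : 0 ≤ C₀)
    (ha : ∀ (l : ℕ) (x : ℝ), x ∈ Set.Icc (-1 : ℝ) 1 → |(|x|) - p l x| ≤ 2 * |x|)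
    (hb : ∀ (l : ℕ) (x : ℝ), x ∈ Set.Icc (-1 : ℝ) 1 → x ≠ 0 → |(|x|) - p l x| ≤ C₀ / (8 ^ l * x ^ 2))
    (J : ℕ) {x : ι → ℝ} (hx : ∀ i, x i ∈ Set.Icc (-1 : ℝ) 1) :
    ∑ l ∈ range J, (2 : ℝ) ^ l * |∑ i, p (l + 1) (x i) - ∑ i, p l (x i)| ≤ (128 + 3 * C₀ / 512) * Fintype.card ι := by
  calc ∑ l ∈ range J, (2 : ℝ) ^ l * |∑ i, p (l + 1) (x i) - ∑ i, p l (x i)|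
      ≤ ∑ l ∈ range J, ∑ i, (2 : ℝ) ^ l * |p (l + 1) (x i) - p l (x i)| := by
        refine Finset.sum_le_sum fun l _ => ?_
        rw [← Finset.sum_sub_distrib, ← Finset.mul_sum]
        exact mul_le_mul_of_nonneg_left (Finset.abs_sum_le_sum_abs _ _) (by positivity)
    _ = ∑ i, ∑ l ∈ range J, (2 : ℝ) ^ l * |p (l + 1) (x i) - p l (x i)| := Finset.sum_comm
    _ ≤ ∑ _i : ι, (128 + 3 * C₀ / 512) := Finset.sum_le_sum fun i _ => sum_two_pow_mul_abs_increment_le hC ha hb J (hx i)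
    _ = (128 + 3 * C₀ / 512) * Fintype.card ι := by rw [Finset.sum_const, Finset.card_univ, nsmul_eq_mul, mul_comm]

/-! ## §3 Module 196's kink-exact family [folklore] -/

/-- ★ **THE KINK-EXACT DYADIC FAMILY AND ITS LEVEL SUM.**  There are real polynomials `p_l` (`l ∈ ℕ`) of degree `≤ 2^{l+1} − 1` with, on `[−1,1]`:
`|p_l(x)| ≤ |x|`, `||x| − p_l(x)| ≤ 2|x|`, `||x| − p_l(x)| ≤ (π⁷∕3)∕(8^l x²)` (`x ≠ 0`), and `Σ_{l<J} 2^l·|p_{l+1}(x) − p_l(x)| ≤ 128 + 3·(π⁷∕3)∕512`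
(`≤ 134`) for every `J`: module 196's `exists_kinkExact_poly_near_abs` at `L = 2^l`, then §1. [folklore] -/
theorem exists_kinkExact_family_levelSum_le :
    ∃ p : ℕ → ℝ[X], (∀ l, (p l).natDegree ≤ 2 ^ (l + 1) - 1) ∧
      (∀ (l : ℕ) (x : ℝ), x ∈ Set.Icc (-1 : ℝ) 1 → |(p l).eval x| ≤ |x|) ∧
      (∀ (l : ℕ) (x : ℝ), x ∈ Set.Icc (-1 : ℝ) 1 → |(|x|) - (p l).eval x| ≤ 2 * |x|) ∧
      (∀ (l : ℕ) (x : ℝ), x ∈ Set.Icc (-1 : ℝ) 1 → x ≠ 0 → |(|x|) - (p l).eval x| ≤ (π ^ 7 / 3) / (8 ^ l * x ^ 2)) ∧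
      ∀ (J : ℕ) (x : ℝ), x ∈ Set.Icc (-1 : ℝ) 1 →
        ∑ l ∈ range J, (2 : ℝ) ^ l * |(p (l + 1)).eval x - (p l).eval x| ≤ 128 + 3 * (π ^ 7 / 3) / 512 := by
  have hfam := fun l : ℕ => exists_kinkExact_poly_near_abs (L := 2 ^ l) Nat.one_le_two_pow
  choose p hdeg h1 h2 h3 using hfam
  have h3' : ∀ (l : ℕ) (x : ℝ), x ∈ Set.Icc (-1 : ℝ) 1 → x ≠ 0 → |(|x|) - (p l).eval x| ≤ (π ^ 7 / 3) / (8 ^ l * x ^ 2) := by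
    intro l x hx hx0
    have h := h3 l x hx hx0
    have e : (((2 ^ l : ℕ) : ℝ)) ^ 3 = (8 : ℝ) ^ l := by
      push_cast
      rw [← pow_mul, mul_comm, pow_mul]; norm_num
    rwa [e] at h
  refine ⟨p, fun l => ?_, h1, h2, h3', fun J x hx => ?_⟩
  · have := hdeg l
    rw [pow_succ]; omega
  · exact sum_two_pow_mul_abs_increment_le (p := fun l x => (p l).eval x) (by positivity) h2 h3' J hx

/-! ## §4 Contrast: a pinned value at the kink makes the level sum grow linearly [bookkeeping] -/

/-- **WHY KINK-EXACTNESS IS NEEDED.**  If the values at the kink are pinned, `a∕2^l ≤ q_l ≤ b∕2^l` for all `l` (think `q_l = p_{2^l}(0)` for the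
plain Fejér ∕ Jackson means of `|x|`, whose value at `0` is `≍ 1∕L`), then `Σ_{l<J} 2^l·|q_l − q_{l+1}| ≥ J·(a − b∕2)`: for `b < 2a` the level sum AT
THE KINK grows linearly with the number of levels, so those level statistics fill the free box of model (M′), not a cross-polytope. [bookkeeping] -/
theorem le_sum_two_pow_mul_abs_increment_of_kinkValue {q : ℕ → ℝ} {a b : ℝ}
    (hqa : ∀ l, a / 2 ^ l ≤ q l) (hqb : ∀ l, q l ≤ b / 2 ^ l) (J : ℕ) :
    (J : ℝ) * (a - b / 2) ≤ ∑ l ∈ range J, (2 : ℝ) ^ l * |q l - q (l + 1)| := by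
  have hterm : ∀ l : ℕ, a - b / 2 ≤ (2 : ℝ) ^ l * |q l - q (l + 1)| := fun l => by
    have h2 : (0 : ℝ) < 2 ^ l := by positivity
    have hlow : a / 2 ^ l - b / 2 ^ (l + 1) ≤ q l - q (l + 1) := by linarith [hqa l, hqb (l + 1)]
    calc a - b / 2 = 2 ^ l * (a / 2 ^ l - b / 2 ^ (l + 1)) := by rw [pow_succ]; field_simp
      _ ≤ 2 ^ l * (q l - q (l + 1)) := mul_le_mul_of_nonneg_left hlow h2.le
      _ ≤ 2 ^ l * |q l - q (l + 1)| := mul_le_mul_of_nonneg_left (le_abs_self _) h2.le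
  calc (J : ℝ) * (a - b / 2) = ∑ _l ∈ range J, (a - b / 2) := by rw [Finset.sum_const, Finset.card_range, nsmul_eq_mul]
    _ ≤ ∑ l ∈ range J, (2 : ℝ) ^ l * |q l - q (l + 1)| := Finset.sum_le_sum fun l _ => hterm l

/-! ## §5 (v1.1, g36) One-sided errors: the level LOADS live in a simplex [bookkeeping]

Module 196's approximants are ONE-SIDED (`|p_L(x)| ≤ |x|`, hence `e_L(x) := |x| − p_L(x) ∈ [0, min(2|x|, C₀∕(L³x²))]`).  Summing the errors themselves
(not the increments) with the dyadic weights gives NON-NEGATIVE level loads of bounded total mass: the normalised loads `η_l(x) = 2^l·Σ_i e_{2^l}(x_i)∕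
((64 + C₀∕192)|ι|)` satisfy `η ≥ 0`, `Σ_l η_l ≤ 1` — a SIMPLEX.  (HOME `numerics/OPEN-PROBLEM.md`, g36: the loads are NOT polynomials — the increments
`η_l − η_{l+1}∕2` of §1–§2 are; in the semiclassical reading the accessible set of the INCREMENTS is a simplex too exactly when the family is monotone,
`p_{2^{l+1}} ≥ p_{2^l}`, and that is where one-sidedness would buy a `√log`; this section types the load half only.) -/

/-- ★★ **THE DYADIC LOAD SUM OF ONE COORDINATE (one-sided errors).**  If `0 ≤ e_l(x) ≤ 2|x|` on `[−1,1]` and `e_l(x) ≤ C₀∕(8^l·x²)` for `x ≠ 0`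
(`C₀ ≥ 0`), then `Σ_{l<J} 2^l·e_l(x) ≤ 64 + C₀∕192` for every `J` and every `x ∈ [−1,1]` (split at `2^m|x| ≤ 16 < 2^{m+1}|x|`: below, `Σ 2^{l+1}|x| ≤
4·2^m|x| ≤ 64`; above, `Σ C₀∕(4^lx²) ≤ (4∕3)·C₀∕256`). [bookkeeping] -/
theorem sum_two_pow_mul_oneSidedError_le {e : ℕ → ℝ → ℝ} {C₀ : ℝ} (hC : 0 ≤ C₀)
    (h0 : ∀ (l : ℕ) (x : ℝ), x ∈ Set.Icc (-1 : ℝ) 1 → 0 ≤ e l x)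
    (ha : ∀ (l : ℕ) (x : ℝ), x ∈ Set.Icc (-1 : ℝ) 1 → e l x ≤ 2 * |x|)
    (hb : ∀ (l : ℕ) (x : ℝ), x ∈ Set.Icc (-1 : ℝ) 1 → x ≠ 0 → e l x ≤ C₀ / (8 ^ l * x ^ 2))
    (J : ℕ) {x : ℝ} (hx : x ∈ Set.Icc (-1 : ℝ) 1) :
    ∑ l ∈ range J, (2 : ℝ) ^ l * e l x ≤ 64 + C₀ / 192 := by
  by_cases hx0 : x = 0
  · have hz : ∀ l : ℕ, e l x = 0 := fun l => by
      have h := ha l x hx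
      rw [hx0, abs_zero, mul_zero] at h
      have h' := h0 l x hx
      rw [hx0] at h'
      rw [hx0]; exact le_antisymm h h'
    have : ∑ l ∈ range J, (2 : ℝ) ^ l * e l x = 0 := Finset.sum_eq_zero fun l _ => by rw [hz, mul_zero]
    rw [this]; positivity
  set a : ℝ := |x| with ha_def
  have ha0 : 0 < a := abs_pos.2 hx0
  have hx2 : x ^ 2 = a ^ 2 := (sq_abs x).symm
  obtain ⟨m, hm1, hm2⟩ := exists_nat_pow_near (show (1 : ℝ) ≤ 16 / a by
    rw [le_div_iff₀ ha0]; have : a ≤ 1 := abs_le.2 ⟨hx.1, hx.2⟩; linarith) one_lt_two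
  have hlow : (2 : ℝ) ^ m * a ≤ 16 := by
    have := mul_le_mul_of_nonneg_right hm1 ha0.le; rwa [div_mul_cancel₀ _ ha0.ne'] at this
  have hhigh : 16 < (2 : ℝ) ^ (m + 1) * a := by
    have := mul_lt_mul_of_pos_right hm2 ha0; rwa [div_mul_cancel₀ _ ha0.ne'] at this
  have hA : ∀ l : ℕ, (2 : ℝ) ^ l * e l x ≤ 2 * (2 ^ l * a) := fun l => by
    calc (2 : ℝ) ^ l * e l x ≤ 2 ^ l * (2 * a) := mul_le_mul_of_nonneg_left (ha l x hx) (by positivity)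
      _ = 2 * (2 ^ l * a) := by ring
  have hB : ∀ l : ℕ, (2 : ℝ) ^ l * e l x ≤ C₀ / (4 ^ l * a ^ 2) := fun l => by
    have h := hb l x hx hx0
    rw [hx2] at h
    have e8 : (8 : ℝ) ^ l = 2 ^ l * 4 ^ l := by rw [← mul_pow]; norm_num
    calc (2 : ℝ) ^ l * e l x ≤ 2 ^ l * (C₀ / (8 ^ l * a ^ 2)) := mul_le_mul_of_nonneg_left h (by positivity)
      _ = C₀ / (4 ^ l * a ^ 2) := by rw [e8]; field_simp
  rw [← Finset.sum_filter_add_sum_filter_not (range J) (fun l => l ≤ m)]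
  have hS1 : ∑ l ∈ (range J).filter (fun l => l ≤ m), (2 : ℝ) ^ l * e l x ≤ 64 := by
    calc ∑ l ∈ (range J).filter (fun l => l ≤ m), (2 : ℝ) ^ l * e l x
        ≤ ∑ l ∈ (range J).filter (fun l => l ≤ m), 2 * (2 ^ l * a) := Finset.sum_le_sum fun l _ => hA l
      _ ≤ ∑ l ∈ range (m + 1), 2 * ((2 : ℝ) ^ l * a) := by
          refine Finset.sum_le_sum_of_subset_of_nonneg (fun l hl => ?_) fun l _ _ => by positivity
          simp only [Finset.mem_filter, Finset.mem_range] at hl ⊢; omega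
      _ = 2 * a * ∑ l ∈ range (m + 1), (2 : ℝ) ^ l := by rw [Finset.mul_sum]; exact Finset.sum_congr rfl fun l _ => by ring
      _ ≤ 2 * a * 2 ^ (m + 1) := mul_le_mul_of_nonneg_left (sum_two_pow_le m) (by positivity)
      _ = 4 * (2 ^ m * a) := by rw [pow_succ]; ring
      _ ≤ 64 := by linarith
  have hS2 : ∑ l ∈ (range J).filter (fun l => ¬ l ≤ m), (2 : ℝ) ^ l * e l x ≤ C₀ / 192 := by
    have hK : 0 ≤ C₀ / (256 : ℝ) := by positivity
    calc ∑ l ∈ (range J).filter (fun l => ¬ l ≤ m), (2 : ℝ) ^ l * e l x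
        ≤ ∑ l ∈ (range J).filter (fun l => ¬ l ≤ m), C₀ / (4 ^ l * a ^ 2) := Finset.sum_le_sum fun l _ => hB l
      _ ≤ ∑ l ∈ Ico (m + 1) (m + 1 + J), C₀ / ((4 : ℝ) ^ l * a ^ 2) := by
          refine Finset.sum_le_sum_of_subset_of_nonneg (fun l hl => ?_) fun l _ _ => by positivity
          simp only [Finset.mem_filter, Finset.mem_range, Finset.mem_Ico] at hl ⊢; omega
      _ = ∑ j ∈ range J, C₀ / ((4 : ℝ) ^ (m + 1 + j) * a ^ 2) := by
          rw [Finset.sum_Ico_eq_sum_range]; simp only [add_tsub_cancel_left]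
      _ ≤ ∑ j ∈ range J, (C₀ / 256) * (1 / 4 : ℝ) ^ j := by
          refine Finset.sum_le_sum fun j _ => ?_
          have h256 : (256 : ℝ) ≤ 4 ^ (m + 1) * a ^ 2 := by
            have e4 : (4 : ℝ) ^ (m + 1) = (2 ^ (m + 1)) ^ 2 := by
              rw [← pow_mul, mul_comm (m + 1) 2, pow_mul]; norm_num
            have e : (4 : ℝ) ^ (m + 1) * a ^ 2 = (2 ^ (m + 1) * a) ^ 2 := by rw [e4, mul_pow]
            have hpos : (0 : ℝ) < 2 ^ (m + 1) * a := by positivity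
            rw [e]; nlinarith
          have h4j : (0 : ℝ) < 4 ^ j := by positivity
          have hden : (256 : ℝ) * 4 ^ j ≤ 4 ^ (m + 1 + j) * a ^ 2 := by
            calc (256 : ℝ) * 4 ^ j ≤ (4 ^ (m + 1) * a ^ 2) * 4 ^ j := mul_le_mul_of_nonneg_right h256 h4j.le
              _ = 4 ^ (m + 1 + j) * a ^ 2 := by rw [pow_add]; ring
          calc C₀ / (4 ^ (m + 1 + j) * a ^ 2) ≤ C₀ / (256 * 4 ^ j) :=
                div_le_div_of_nonneg_left hC (by positivity) hden
            _ = (C₀ / 256) * (1 / 4 : ℝ) ^ j := by rw [one_div_pow]; field_simp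
      _ = (C₀ / 256) * ∑ j ∈ range J, (1 / 4 : ℝ) ^ j := by rw [Finset.mul_sum]
      _ ≤ (C₀ / 256) * (4 / 3) := mul_le_mul_of_nonneg_left (geom_sum_quarter_le J) hK
      _ = C₀ / 192 := by ring
  linarith

/-- ★★ **THE LEVEL LOADS OF A ONE-SIDED KINK-EXACT LADDER LIVE IN A SIMPLEX.**  With `E_l(x) = Σ_i e_l(x_i) ≥ 0` for a family as above and any point of
the cube: `Σ_{l<J} 2^l·E_l(x) ≤ (64 + C₀∕192)·|ι|` — the normalised loads `η_l = 2^lE_l∕((64 + C₀∕192)|ι|)` are `≥ 0` with `Σ_lη_l ≤ 1`. [bookkeeping] -/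
theorem sum_two_pow_mul_additive_oneSidedError_le {ι : Type*} [Fintype ι] {e : ℕ → ℝ → ℝ} {C₀ : ℝ} (hC : 0 ≤ C₀)
    (h0 : ∀ (l : ℕ) (x : ℝ), x ∈ Set.Icc (-1 : ℝ) 1 → 0 ≤ e l x)
    (ha : ∀ (l : ℕ) (x : ℝ), x ∈ Set.Icc (-1 : ℝ) 1 → e l x ≤ 2 * |x|)
    (hb : ∀ (l : ℕ) (x : ℝ), x ∈ Set.Icc (-1 : ℝ) 1 → x ≠ 0 → e l x ≤ C₀ / (8 ^ l * x ^ 2))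
    (J : ℕ) {x : ι → ℝ} (hx : ∀ i, x i ∈ Set.Icc (-1 : ℝ) 1) :
    ∑ l ∈ range J, (2 : ℝ) ^ l * ∑ i, e l (x i) ≤ (64 + C₀ / 192) * Fintype.card ι := by
  calc ∑ l ∈ range J, (2 : ℝ) ^ l * ∑ i, e l (x i) = ∑ i, ∑ l ∈ range J, (2 : ℝ) ^ l * e l (x i) := by
        rw [Finset.sum_comm]; exact Finset.sum_congr rfl fun l _ => by rw [Finset.mul_sum]
    _ ≤ ∑ _i : ι, (64 + C₀ / 192) := Finset.sum_le_sum fun i _ => sum_two_pow_mul_oneSidedError_le hC h0 ha hb J (hx i)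
    _ = (64 + C₀ / 192) * Fintype.card ι := by rw [Finset.sum_const, Finset.card_univ, nsmul_eq_mul, mul_comm]

/-- ★ **MODULE 196's FAMILY IS ONE-SIDED WITH SIMPLEX LOADS.**  There are real polynomials `p_l` of degree `≤ 2^{l+1} − 1` with, on `[−1,1]`:
`0 ≤ |x| − p_l(x) ≤ 2|x|`, `|x| − p_l(x) ≤ (π⁷∕3)∕(8^l x²)` (`x ≠ 0`), and `Σ_{l<J} 2^l·(|x| − p_l(x)) ≤ 64 + (π⁷∕3)∕192` (`≤ 70`) for every `J`. [folklore] -/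
theorem exists_oneSided_family_loadSum_le :
    ∃ p : ℕ → ℝ[X], (∀ l, (p l).natDegree ≤ 2 ^ (l + 1) - 1) ∧
      (∀ (l : ℕ) (x : ℝ), x ∈ Set.Icc (-1 : ℝ) 1 → 0 ≤ |x| - (p l).eval x ∧ |x| - (p l).eval x ≤ 2 * |x|) ∧
      (∀ (l : ℕ) (x : ℝ), x ∈ Set.Icc (-1 : ℝ) 1 → x ≠ 0 → |x| - (p l).eval x ≤ (π ^ 7 / 3) / (8 ^ l * x ^ 2)) ∧
      ∀ (J : ℕ) (x : ℝ), x ∈ Set.Icc (-1 : ℝ) 1 →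
        ∑ l ∈ range J, (2 : ℝ) ^ l * (|x| - (p l).eval x) ≤ 64 + (π ^ 7 / 3) / 192 := by
  obtain ⟨p, hdeg, h1, h2, h3, _⟩ := exists_kinkExact_family_levelSum_le
  have hpos : ∀ (l : ℕ) (x : ℝ), x ∈ Set.Icc (-1 : ℝ) 1 → 0 ≤ |x| - (p l).eval x := fun l x hx => by
    have := (abs_le.1 (h1 l x hx)).2; linarith
  have hup : ∀ (l : ℕ) (x : ℝ), x ∈ Set.Icc (-1 : ℝ) 1 → |x| - (p l).eval x ≤ 2 * |x| := fun l x hx =>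
    (le_abs_self _).trans (h2 l x hx)
  have hup' : ∀ (l : ℕ) (x : ℝ), x ∈ Set.Icc (-1 : ℝ) 1 → x ≠ 0 → |x| - (p l).eval x ≤ (π ^ 7 / 3) / (8 ^ l * x ^ 2) :=
    fun l x hx hx0 => (le_abs_self _).trans (h3 l x hx hx0)
  refine ⟨p, hdeg, fun l x hx => ⟨hpos l x hx, hup l x hx⟩, hup', fun J x hx => ?_⟩
  exact sum_two_pow_mul_oneSidedError_le (e := fun l x => |x| - (p l).eval x) (by positivity) hpos hup hup' J hx

end Summit.QuantumFields.YangMills.Theorems.BalabanUVNodesN19LevelStatisticsCrossPolytope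

end
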